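import Literature.MathematicalPhysics.QuantumFieldTheory.Balaban1983to89.B9Eq358TaxiLettersY
import Literature.MathematicalPhysics.QuantumFieldTheory.Balaban1983to89.B9SectBGpFrameCodedY
import Literature.MathematicalPhysics.QuantumFieldTheory.Balaban1983to89.Node00.OpsYRead342Cross
import Literature.MathematicalPhysics.QuantumFieldTheory.Balaban1983to89.B9RWSumsCompleteGeo9YNbr
import Literature.MathematicalPhysics.QuantumFieldTheory.Balaban1983to89.B9BetaRangeKLevelV1

/-!
# `Balaban1983to89.B9SectBCodedClassY` — THE CODED CLASS `C37` OF THE SECT.-B CHAIN AT NODE 00: `C37 := «U G-valued» ∧ CplxLettersY`, its letters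
# DERIVED from the record's class (3.37) (`B9BackgroundsKLevelV1.Cplx337Body` = r06's `B9Eq335RegularityClasses.Cplx337` on the torus chart), and the
# class hypothesis `hclass` of `B9SectBCodedCarrier.sectBStepPrinted_of_coded`

T. Bałaban, *Propagators for lattice gauge theories in a background field*, Commun. Math. Phys. **99** (1985) 389–434
[`Balaban1985BackgroundPropagators`, "B9"]; T. Bałaban, *Propagators and renormalization transformations for lattice gauge
theories. II*, Commun. Math. Phys. **96** (1984) 223–250 [`Balaban1984PropagatorsII`, "[4]"].

statement-level skeleton of published theorems with citation tags; proofs where landed; nothing here is a claim about the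
Yang–Mills mass gap

THE PRINTED LOCUS.  (3.37) p. 396: *«U′ = e^{iηA′}, A′ … |A′| < α₁(Lʲη)⁻¹, |∇^η_U A′| < α₁(Lʲη)⁻² on Ω_j»*; p. 397 (after (3.41)): the own-level reading;
(3.58)–(3.59) p. 402 (the variation letters of the averaging).

WHY THIS FILE (pub-ymgap N06 row 13, seat dag-n06-c g8, INTENT-3).  The root Sect.-B frame over the coded carrier (`B9SectBGpFrameCodedY.gpFrame₂Coded`,
p570060) and the letter conversion (`B9SectBGpTransferConvY.hconv_at`, p583550) take the coded class `C37` through ONE dictionary hypothesis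
`hC37 : C37 β U a → GVal U ∧ CplxLettersY … β U a`; the transfer back to the record (`B9SectBCodedCarrier.sectBStepPrinted_of_coded`, p561226) asks
`hclass`: every `U′` of the record's class (3.37) at `α₁` has a code `a` in `C37 (r·α₁) U`.  Here `C37` is DEFINED as that conjunction (`C37Y`, so `hC37`
holds by projection) and its seven letter bounds are DERIVED at NODE 00's letters (transporter `parSymY`) from r06's class on the torus chart:
clauses 1–2 = (3.58)∕(3.59) (`B9Eq358TaxiLettersY`), clauses 3–7 = (3.37) read through the box chart with one factor `L` per backward shift
(neighbouring blocks differ by at most one level once `2(d+1) < M`), so `r = L⁴`.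

WHAT THIS FILE PROVES (0 sorry; ONE definition `C37Y`):
* §1 the chart transports `boxEquiv_symm_shiftY_symm`, `covD_chart`, `covDstar_chart`, `tauB_chart` (`shiftY ∕ UboxY ∕ chartA` ↔ `shiftsV1 ∕ U ∕ a`),
  `covD_tauB_eq_neg_covDstar`, `norm_R_le_of_unitaryLike`, `levV1_boxEquiv_symm`, ★ `len_blkC_eq_scaleLen`, `len_blkC_le_mul_symm_shift`.
* §2 ★★ `cplxLettersY_of_cplx337` — all seven clauses of `CplxLettersY G x (parSymY x.toKIdx) ιB Cq (L⁴α₁) U a`, `Cq = 4(d+1)e^{3(d+1)/2}`, from r06's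
  `Cplx337 (shiftsV1 _) U η L (levV1 x.toKIdx) α₁ a`, `U` `G`-valued, the member's section `ιB` (`hι`), `2(d+1) < M`, `0 < α₁ ≤ 1∕4`.
* §3 `C37Y` (the definition), `gVal_of_C37Y`, `cplxLettersY_of_C37Y` (the `hC37` of `gpFrame₂Coded`).
* §4 ★★ `hclass_C37Y_at` (ONE member) and `hclass_C37Y` (the family-level `hclass` of `sectBStepPrinted_of_coded` with `r := L⁴`, `αcap := 1∕4`,
  `Mc := 2(d+1)+1`).
* §5 ★ `exists_memberY_surjective_beta`, `exists_memberY_section` — corner-free members (hence members with a section `ιB`, `hι`) EXIST at `L = 5` for every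
  `k ≥ 2` and beyond every `M`-threshold: the per-member statements of the chain are non-vacuous there.

HONEST SCOPE.  A dictionary between two typed readings of (3.37) plus the landed (3.58) estimate; nothing of Thm 3.1 asserted; COUNT-NEUTRAL; N06 NOT
discharged.  The block labels `ιB` are a SECTION of `β` (`hι`): per member in §1–§3 and in `hclass_C37Y_at` (honest at every corner-free member,
`B9BetaRangeKLevelV1.surjective_beta_iff`); the FAMILY-LEVEL binder `hι : ∀ (x : MemberY …) s, …` of `hclass_C37Y` reads «every served member is
corner-free» and is REFUTED at the served member type by def-Y's `Node00.MemberYCornered.not_forall_memberY_beta_section` (this seat's LOCATED-7 and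
`B9SectBGpTransferConvY` v1.1) — `hclass_C37Y` is an honest implication with an antecedent false at `MemberY …` and becomes non-vacuous only over a
corner-free sub-family; its content is `hclass_C37Y_at`.  One finite lattice programme — nothing continuum ∕ OS ∕ mass-gap ∕ Clay.  Cell `pub-ymgap` (HUMAN
RULING D-0062), Track A node N06 [B9], N06-ASSIGNMENT row 13, 2026-08-27.

RELATED IN THE TREE, NOT DUPLICATED: `B9SectBGpFrameCodedY` (`CplxLettersY`, `codingYx`), `B9SectBCodedCarrier` (`sectBStepPrinted_of_coded`),
`B9Eq358TaxiLettersY` ((3.58)∕(3.59)), `B9Eq335RegularityClasses` (r06's classes), `B9BackgroundsKLevelV1` (`Cplx337Body`, `levV1`), `Node00.OpsYGauge`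
(`boxEquiv_symm_shiftY`), `Node00.OpsYRead342Cross` (`len_blkC_symm_shift_le`), `B9RWSumsCompleteGeo9YNbr` (`len_le_of_dist_lt_M_geo9K`).
-/

noncomputable section

namespace Literature.MathematicalPhysics.QuantumFieldTheory.Balaban1983to89.B9SectBCodedClassY

open Complex
open T4RelativeLadder (UnitaryLike)
open B4Reflection242 (boxDom)
open B6MultiLevelBoxOperator (N0)
open B6Geom246MultiLevelBox (bset blkOf blkOf_val)
open B6GlobalChartV1 (PV toBox boxEquiv toBox_apply boxEquiv_apply)
open B6KLevelCensusIndexV1 (KIdx kGeo)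
open B6Ineq2142KLevelV1 (β lvl beta_level)
open B9BackgroundsKLevelV1 (CfgV1 shiftsV1 levV1 Cplx337Body)
open B9Eq39Adjoint (R covD covDstar fluct R_inv_R R_sub R_neg R_smul)
open B9Eq352DivForm (tauB)
open B9Eq370Expansion (norm_R_le)
open B9Eq371Composition (covDstar_eq_neg_R_covD)
open B9Eq335RegularityClasses (Cplx337 OnOmega)
open LatticeNorms (scaleLen)
open B9Eq360DeltaPrimeAY (kQY sQY kFY sFY mulY AfldY chartA blkY blkY_apply)
open B9PinMembersKLevelV1 (MemberY geo9Y bg9Y)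
open B9SectBCodedCarrier (CCfg)
open B9SectBGpLettersY (GVal coordC expAC blkC kFC sFC wC norm_le_one_and_inv_of_mem letters_base_of_gVal stencilB_blkC)
open B9SectBGpFrameCodedY (codingYx CplxLettersY)
open B9Eq358TaxiLettersY (norm_kFY_parSymY_le norm_sFY_parSymY_le)
open B9RWSumsCompleteGeo9YNbr (len_le_of_dist_lt_M_geo9K)
open B9GeoLemma21KLevelV1 (geo9Y_len_pos geo9K_eta_pos geo9K_one_le_L)
open Node00 (SiteY BlkY IBondY CfgY SiteParY UboxY shiftY blkCornerY parSymY boxEquiv_symm_shiftY)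

variable {𝔸 : Type} [NormedRing 𝔸] [NormedAlgebra ℂ 𝔸] [CompleteSpace 𝔸]
variable {d ℓ : ℕ} {hd : 1 ≤ d + 1} {hL : Odd (ℓ + 1) ∧ 1 < ℓ + 1} {b₀ b₁ : ℝ}

/-! ## §1 Chart transports and the level ∕ length dictionary -/

section Chart

variable (i : KIdx d ℓ hd hL b₀ b₁)

omit [NormedRing 𝔸] [NormedAlgebra ℂ 𝔸] [CompleteSpace 𝔸] in
/-- the backward box shift read through the chart: `boxEquiv⁻¹(z − e_μ) = boxEquiv⁻¹(z) − e_μ`. [cite: Balaban1984PropagatorsII, (2.1) p.224, dictionary] -/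
theorem boxEquiv_symm_shiftY_symm (μ : Fin (d + 1)) (z : SiteY i) :
    (boxEquiv i.hN).symm ((shiftY i μ).symm z) = (shiftsV1 (PV d ℓ i.m i.K hd hL) μ).symm ((boxEquiv i.hN).symm z) := by
  rw [Equiv.eq_symm_apply]
  show ((boxEquiv i.hN).symm ((shiftY i μ).symm z)).shift μ = (boxEquiv i.hN).symm z
  rw [← boxEquiv_symm_shiftY, Equiv.apply_symm_apply]

/-- **`∇_U` THROUGH THE CHART**: the box-chart covariant difference of a charted field is the torus one. [cite: Balaban1985BackgroundPropagators, (3.3) p.390, dictionary] -/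
theorem covD_chart (U : CfgY 𝔸 i) (μ : Fin (d + 1)) (f : Site (PV d ℓ i.m i.K hd hL) 0 → 𝔸) (z : SiteY i) :
    covD (shiftY i) (UboxY i U) μ (fun w => f ((boxEquiv i.hN).symm w)) z = covD (shiftsV1 (PV d ℓ i.m i.K hd hL)) U μ f ((boxEquiv i.hN).symm z) := by
  simp only [covD, UboxY, boxEquiv_symm_shiftY]
  rfl

/-- **`∇*_U` THROUGH THE CHART**. [cite: Balaban1985BackgroundPropagators, (3.8) p.392, dictionary] -/
theorem covDstar_chart (U : CfgY 𝔸 i) (μ : Fin (d + 1)) (f : Site (PV d ℓ i.m i.K hd hL) 0 → 𝔸) (z : SiteY i) :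
    covDstar (shiftY i) (UboxY i U) μ (fun w => f ((boxEquiv i.hN).symm w)) z
      = covDstar (shiftsV1 (PV d ℓ i.m i.K hd hL)) U μ f ((boxEquiv i.hN).symm z) := by
  simp only [covDstar, UboxY, boxEquiv_symm_shiftY_symm]

/-- **the backward transport `τ*_μ` THROUGH THE CHART**. [cite: Balaban1985BackgroundPropagators, (3.8) p.392, dictionary] -/
theorem tauB_chart (U : CfgY 𝔸 i) (μ : Fin (d + 1)) (f : Site (PV d ℓ i.m i.K hd hL) 0 → 𝔸) (z : SiteY i) :
    tauB (shiftY i) (UboxY i U) μ (fun w => f ((boxEquiv i.hN).symm w)) z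
      = tauB (shiftsV1 (PV d ℓ i.m i.K hd hL)) U μ f ((boxEquiv i.hN).symm z) := by
  simp only [tauB, UboxY, boxEquiv_symm_shiftY_symm]

omit [NormedAlgebra ℂ 𝔸] [CompleteSpace 𝔸] in
/-- `∇_μ ∘ τ*_μ = −∇*_μ` (the forward difference of the backward transport). [cite: Balaban1985BackgroundPropagators, (3.3) p.390, (3.8) p.392, bookkeeping] -/
theorem covD_tauB_eq_neg_covDstar {S ι' : Type} (T : ι' → Equiv.Perm S) (V : ι' → S → 𝔸ˣ) (μ : ι') (f : S → 𝔸) (w : S) :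
    covD T V μ (tauB T V μ f) w = -covDstar T V μ f w := by
  simp only [covD, covDstar, tauB, Equiv.symm_apply_apply, neg_sub]
  rw [← B9Eq39Adjoint.R_mul, mul_inv_cancel, B9Eq39Adjoint.R_one]

omit [NormedAlgebra ℂ 𝔸] [CompleteSpace 𝔸] in
/-- transport by a unitary-like bond variable (or its inverse) does not increase norms. [cite: Balaban1985BackgroundPropagators, (3.35) p.396 («U … in G»), bookkeeping] -/
theorem norm_R_le_of_unitaryLike {u : 𝔸ˣ} (hu : UnitaryLike u) (X : 𝔸) : ‖R u X‖ ≤ ‖X‖ ∧ ‖R u⁻¹ X‖ ≤ ‖X‖ := by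
  constructor
  · calc ‖R u X‖ ≤ ‖(u : 𝔸)‖ * ‖X‖ * ‖((u⁻¹ : 𝔸ˣ) : 𝔸)‖ := norm_R_le u X
      _ ≤ 1 * ‖X‖ * 1 := by gcongr; exacts [hu.1, hu.2]
      _ = ‖X‖ := by ring
  · calc ‖R u⁻¹ X‖ ≤ ‖((u⁻¹ : 𝔸ˣ) : 𝔸)‖ * ‖X‖ * ‖((u⁻¹⁻¹ : 𝔸ˣ) : 𝔸)‖ := norm_R_le u⁻¹ X
      _ ≤ 1 * ‖X‖ * 1 := by rw [inv_inv]; gcongr; exacts [hu.2, hu.1]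
      _ = ‖X‖ := by ring

omit [NormedRing 𝔸] [NormedAlgebra ℂ 𝔸] [CompleteSpace 𝔸] in
/-- the level of a box site through the chart: `levV1 (boxEquiv⁻¹ z) = lev z`. [cite: Balaban1984PropagatorsII, (2.1)–(2.4) p.224, dictionary] -/
theorem levV1_boxEquiv_symm (z : SiteY i) : levV1 i ((boxEquiv i.hN).symm z) = (blkOf i.D.toDomains z).1.1 := by
  show i.D.lev (toBox i.hN ((boxEquiv i.hN).symm z)).1 = i.D.lev z.1
  rw [← boxEquiv_apply, Equiv.apply_symm_apply]

variable (ιB : BlkY i → IBondY i)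

omit [NormedRing 𝔸] [NormedAlgebra ℂ 𝔸] [CompleteSpace 𝔸] in
/-- ★ **THE FRAME'S BLOCK LENGTH IS THE PRINTED SCALE `Lʲη` AT THE SITE'S LEVEL**: `ℓ(ιB(Δ(z))) = L^{lev z}·η = scaleLen L η (levV1 (boxEquiv⁻¹ z))`
(`ιB` a section of `β`). [cite: Balaban1985BackgroundPropagators, (3.41) p.397 («Lʲη»), (3.37) p.396, dictionary] -/
theorem len_blkC_eq_scaleLen (hι : ∀ s : BlkY i, β i.hN i.D i.hk (ιB s) = s) (z : SiteY i) :
    (B9GeoNormsKLevelV1.geo9K i).len (blkC i ιB z) = scaleLen (kGeo i).L (kGeo i).eta (levV1 i ((boxEquiv i.hN).symm z)) := by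
  have hk1 : 1 ≤ i.k := le_trans one_le_two i.hk2
  rw [levV1_boxEquiv_symm]
  show (kGeo i).L ^ lvl i.hN i.D i.hk (ιB (blkY i z)) * (kGeo i).eta = (kGeo i).L ^ (blkOf i.D.toDomains z).1.1 * (kGeo i).eta
  rw [← beta_level i.hN i.D i.hk hk1, hι, blkY_apply]

omit [NormedRing 𝔸] [NormedAlgebra ℂ 𝔸] [CompleteSpace 𝔸] in
/-- neighbouring blocks differ by at most one level (`2(d+1) < M`): `ℓ(Δ(z)) ≤ L·ℓ(Δ(z − e_μ))` and `ℓ(Δ(z − e_μ)) ≤ L·ℓ(Δ(z))`.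
[cite: Balaban1984PropagatorsII, (2.2) p.224, Lemma 2.1 (2.60) p.234; Balaban1985BackgroundPropagators, p.397] -/
theorem len_blkC_le_mul_symm_shift (hι : ∀ s : BlkY i, β i.hN i.D i.hk (ιB s) = s) (hdM : 2 * ((d : ℝ) + 1) < (B9GeoNormsKLevelV1.geo9K i).M)
    (μ : Fin (d + 1)) (z : SiteY i) :
    (B9GeoNormsKLevelV1.geo9K i).len (blkC i ιB z) ≤ ((ℓ + 1 : ℕ) : ℝ) * (B9GeoNormsKLevelV1.geo9K i).len (blkC i ιB ((shiftY i μ).symm z)) ∧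
      (B9GeoNormsKLevelV1.geo9K i).len (blkC i ιB ((shiftY i μ).symm z)) ≤ ((ℓ + 1 : ℕ) : ℝ) * (B9GeoNormsKLevelV1.geo9K i).len (blkC i ιB z) :=
  ⟨len_le_of_dist_lt_M_geo9K i (lt_of_le_of_lt (stencilB_blkC i ιB hι μ z) hdM),
    Node00.OpsYRead342Cross.len_blkC_symm_shift_le i ιB hι hdM μ z⟩

end Chart

/-! ## §2 ★★ The seven letter bounds from the record's class (3.37) -/

section Letters

variable [NormOneClass 𝔸] {Mstar : ℕ} (G : Subgroup 𝔸ˣ) (x : MemberY d ℓ hd hL b₀ b₁ Mstar) (ιB : BlkY x.toKIdx → IBondY x.toKIdx)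

/-- the constant `C_q = 4(d+1)e^{3(d+1)/2}` of the (3.58)∕(3.59) letters and the rescaling `r = L⁴` of the class exponent, as they occur below.
[cite: Balaban1985BackgroundPropagators, (3.58) p.402, (3.37) p.396, bookkeeping] -/
theorem constants_nonneg : 0 ≤ 4 * ((d : ℝ) + 1) * Real.exp (3 * (((d : ℝ) + 1) / 2)) ∧ (1 : ℝ) ≤ ((ℓ : ℝ) + 1) ^ 4 :=
  ⟨by positivity, one_le_pow₀ (by have : (0 : ℝ) ≤ ℓ := Nat.cast_nonneg _; linarith)⟩

/-- ★★ **THE CODED CLASS LETTERS FROM (3.37)**: at a `G`-valued `U` (unit-norm `G`), for `a` in r06's class `Cplx337` on the member's torus chart at exponent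
`0 < α₁ ≤ 1∕4`, above `2(d+1) < M`, the seven bounds of `CplxLettersY G x (parSymY x.toKIdx) ιB Cq (L⁴α₁) U a` hold with `Cq = 4(d+1)e^{3(d+1)/2}`:
(1)–(2) the variation letters `kF`, `sF` ((3.58)∕(3.59), `B9Eq358TaxiLettersY`); (3)–(5) the covariant differences of `a` and of its backward
transport (one factor `L` per backward shift); (6)–(7) the values of `a` and of `τ*a`. [cite: Balaban1985BackgroundPropagators, (3.37) p.396, p.397, (3.58)–(3.59) p.402] -/
theorem cplxLettersY_of_cplx337 (hι : ∀ s : BlkY x.toKIdx, β x.toKIdx.hN x.toKIdx.D x.toKIdx.hk (ιB s) = s)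
    (hG1 : ∀ u : 𝔸ˣ, u ∈ G → ‖(u : 𝔸)‖ ≤ 1) (hdM : 2 * ((d : ℝ) + 1) < (geo9Y x).M)
    {U : CfgY 𝔸 x.toKIdx} (hU : GVal G x.toKIdx U) {α₁ : ℝ} (hα₁ : 0 < α₁) (hα₁4 : α₁ ≤ 1 / 4) {a : AfldY 𝔸 x.toKIdx}
    (h : Cplx337 (shiftsV1 (PV d ℓ x.m x.K hd hL)) U (kGeo x.toKIdx).eta (kGeo x.toKIdx).L (levV1 x.toKIdx) α₁ a) :
    CplxLettersY G x (parSymY x.toKIdx) ιB (4 * ((d : ℝ) + 1) * Real.exp (3 * (((d : ℝ) + 1) / 2))) ((((ℓ : ℝ) + 1) ^ 4) * α₁) U a := by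
  set η : ℝ := (kGeo x.toKIdx).eta with hη
  set Lr : ℝ := ((ℓ : ℝ) + 1) with hLr
  set Cq : ℝ := 4 * ((d : ℝ) + 1) * Real.exp (3 * (((d : ℝ) + 1) / 2)) with hCq
  have hη0 : 0 < η := geo9K_eta_pos x.toKIdx
  have hL1 : (1 : ℝ) ≤ Lr := by rw [hLr]; have : (0 : ℝ) ≤ ℓ := Nat.cast_nonneg _; linarith
  have hLeq : (kGeo x.toKIdx).L = Lr := by rw [hLr]; show (((ℓ + 1 : ℕ) : ℝ)) = _; push_cast; ring
  have hLn : (((ℓ + 1 : ℕ) : ℝ)) = Lr := by rw [hLr]; push_cast; ring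
  have hL4 : (1 : ℝ) ≤ Lr ^ 4 := one_le_pow₀ hL1
  have hCq0 : 0 ≤ Cq := by positivity
  have hUu : ∀ μ v, UnitaryLike (U μ v) := fun μ v => norm_le_one_and_inv_of_mem G hG1 (hU μ v)
  have hco : coordC G x.toKIdx (.base U) = UboxY x.toKIdx U := (letters_base_of_gVal G x.toKIdx (parSymY x.toKIdx) hU).1
  have hexp : expAC x.toKIdx (.base U) (.mult a) = chartA x.toKIdx a := rfl
  have hlen0 : ∀ z : SiteY x.toKIdx, 0 < (geo9Y x).len (blkC x.toKIdx ιB z) := fun z => geo9Y_len_pos x _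
  -- the class bounds at a torus point `v` and its own level, in terms of the frame's block length
  obtain ⟨hA, hDA⟩ := h
  have hscale : ∀ z : SiteY x.toKIdx, scaleLen (kGeo x.toKIdx).L (kGeo x.toKIdx).eta (levV1 x.toKIdx ((boxEquiv x.toKIdx.hN).symm z)) = (geo9Y x).len (blkC x.toKIdx ιB z) :=
    fun z => (len_blkC_eq_scaleLen x.toKIdx ιB hι z).symm
  have hA' : ∀ (κ : Fin (d + 1)) (z : SiteY x.toKIdx), ‖a κ ((boxEquiv x.toKIdx.hN).symm z)‖ ≤ α₁ * ((geo9Y x).len (blkC x.toKIdx ιB z))⁻¹ := fun κ z => by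
    have := hA _ κ ((boxEquiv x.toKIdx.hN).symm z) le_rfl
    rw [hscale] at this; exact this.le
  have hDA' : ∀ (μ ν : Fin (d + 1)) (z : SiteY x.toKIdx),
      ‖((η : ℂ)⁻¹) • covD (shiftsV1 _) U μ (a ν) ((boxEquiv x.toKIdx.hN).symm z)‖ ≤ α₁ * ((geo9Y x).len (blkC x.toKIdx ιB z) ^ 2)⁻¹ := fun μ ν z => by
    have := hDA _ μ ν ((boxEquiv x.toKIdx.hN).symm z) le_rfl
    rw [hscale] at this; exact this.le
  -- neighbour bookkeeping: `ℓ(Δ(z − e_μ))⁻¹ ≤ L·ℓ(Δ(z))⁻¹`, `ℓ(Δ(z − e_μ))⁻² ≤ L²·ℓ(Δ(z))⁻²`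
  have hnb : ∀ (μ : Fin (d + 1)) (z : SiteY x.toKIdx), ((geo9Y x).len (blkC x.toKIdx ιB ((shiftY x.toKIdx μ).symm z)))⁻¹ ≤ Lr * ((geo9Y x).len (blkC x.toKIdx ιB z))⁻¹ ∧
      ((geo9Y x).len (blkC x.toKIdx ιB ((shiftY x.toKIdx μ).symm z)) ^ 2)⁻¹ ≤ Lr ^ 2 * ((geo9Y x).len (blkC x.toKIdx ιB z) ^ 2)⁻¹ := by
    intro μ z
    have h1 := (len_blkC_le_mul_symm_shift x.toKIdx ιB hι hdM μ z).1
    rw [hLn] at h1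
    have hp := hlen0 ((shiftY x.toKIdx μ).symm z)
    have hq := hlen0 z
    have e1 : ((geo9Y x).len (blkC x.toKIdx ιB ((shiftY x.toKIdx μ).symm z)))⁻¹ ≤ Lr * ((geo9Y x).len (blkC x.toKIdx ιB z))⁻¹ := by
      rw [inv_le_comm₀ hp (by positivity), mul_inv, inv_inv]
      calc Lr⁻¹ * (geo9Y x).len (blkC x.toKIdx ιB z) ≤ Lr⁻¹ * (Lr * (geo9Y x).len (blkC x.toKIdx ιB ((shiftY x.toKIdx μ).symm z))) :=
            mul_le_mul_of_nonneg_left h1 (by positivity)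
        _ = _ := by field_simp
    refine ⟨e1, ?_⟩
    have e2 := mul_le_mul e1 e1 (by positivity) (by positivity)
    calc ((geo9Y x).len (blkC x.toKIdx ιB ((shiftY x.toKIdx μ).symm z)) ^ 2)⁻¹
        = ((geo9Y x).len (blkC x.toKIdx ιB ((shiftY x.toKIdx μ).symm z)))⁻¹ * ((geo9Y x).len (blkC x.toKIdx ιB ((shiftY x.toKIdx μ).symm z)))⁻¹ := by rw [sq, mul_inv]
      _ ≤ (Lr * ((geo9Y x).len (blkC x.toKIdx ιB z))⁻¹) * (Lr * ((geo9Y x).len (blkC x.toKIdx ιB z))⁻¹) := e2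
      _ = Lr ^ 2 * ((geo9Y x).len (blkC x.toKIdx ιB z) ^ 2)⁻¹ := by rw [sq, sq, mul_inv]; ring
  -- (3): `η⁻¹∇*_ν a_k (z) = −R(…)⁻¹ η⁻¹∇_ν a_k (z − e_ν)`, one neighbour step
  have h3 : ∀ (ν k : Fin (d + 1)) (z : SiteY x.toKIdx),
      ‖((η : ℂ)⁻¹) • covDstar (shiftY x.toKIdx) (UboxY x.toKIdx U) ν (chartA x.toKIdx a k) z‖ ≤ Lr ^ 2 * α₁ * ((geo9Y x).len (blkC x.toKIdx ιB z) ^ 2)⁻¹ := by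
    intro ν k z
    have hc : covDstar (shiftY x.toKIdx) (UboxY x.toKIdx U) ν (chartA x.toKIdx a k) z
        = -R (UboxY x.toKIdx U ν ((shiftY x.toKIdx ν).symm z))⁻¹ (covD (shiftY x.toKIdx) (UboxY x.toKIdx U) ν (chartA x.toKIdx a k) ((shiftY x.toKIdx ν).symm z)) :=
      covDstar_eq_neg_R_covD _ _ ν _ z
    rw [hc, smul_neg, norm_neg, ← R_smul]
    have hu : UnitaryLike (UboxY x.toKIdx U ν ((shiftY x.toKIdx ν).symm z)) := hUu ν _
    refine ((norm_R_le_of_unitaryLike hu _).2).trans ?_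
    have hd := hDA' ν k ((shiftY x.toKIdx ν).symm z)
    rw [← covD_chart x.toKIdx U ν (a k)] at hd
    refine hd.trans ?_
    have := (hnb ν z).2
    nlinarith [hα₁.le]
  refine ⟨?_, ?_, ?_, ?_, ?_, ?_, ?_⟩
  · -- (1) the kernel variation letter `kF` ((3.58))
    intro y z hzy
    have hs : blkOf x.toKIdx.D.toDomains z = β x.toKIdx.hN x.toKIdx.D x.toKIdx.hk y := by
      have : β x.toKIdx.hN x.toKIdx.D x.toKIdx.hk (blkC x.toKIdx ιB z) = blkY x.toKIdx z := by rw [blkC, hι]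
      rw [hzy] at this; rw [← blkY_apply, this]
    have ha : ∀ (ν : Fin (d + 1)) (v : Site (PV d ℓ x.m x.K hd hL) 0), blkOf x.toKIdx.D.toDomains (toBox x.toKIdx.hN v) = β x.toKIdx.hN x.toKIdx.D x.toKIdx.hk y →
        η * ‖a ν v‖ ≤ α₁ * ((((ℓ + 1) ^ (β x.toKIdx.hN x.toKIdx.D x.toKIdx.hk y).1.1 : ℕ) : ℝ))⁻¹ := by
      intro ν v hv
      have hlev : levV1 x.toKIdx v = (β x.toKIdx.hN x.toKIdx.D x.toKIdx.hk y).1.1 := by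
        show x.toKIdx.D.lev (toBox x.toKIdx.hN v).1 = _; rw [← hv]; rfl
      have hb := hA _ ν v (le_of_eq hlev.symm)
      have e : scaleLen (kGeo x.toKIdx).L (kGeo x.toKIdx).eta (β x.toKIdx.hN x.toKIdx.D x.toKIdx.hk y).1.1 = (((ℓ + 1) ^ (β x.toKIdx.hN x.toKIdx.D x.toKIdx.hk y).1.1 : ℕ) : ℝ) * η := by
        rw [scaleLen, hLeq, ← hLn]; push_cast; ring
      rw [e, mul_inv] at hb
      have hpow : (0 : ℝ) < (((ℓ + 1) ^ (β x.toKIdx.hN x.toKIdx.D x.toKIdx.hk y).1.1 : ℕ) : ℝ) := by positivity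
      calc η * ‖a ν v‖ ≤ η * (α₁ * (((((ℓ + 1) ^ (β x.toKIdx.hN x.toKIdx.D x.toKIdx.hk y).1.1 : ℕ) : ℝ))⁻¹ * η⁻¹)) := mul_le_mul_of_nonneg_left hb.le hη0.le
        _ = α₁ * ((((ℓ + 1) ^ (β x.toKIdx.hN x.toKIdx.D x.toKIdx.hk y).1.1 : ℕ) : ℝ))⁻¹ := by field_simp
    have hk := norm_kFY_parSymY_le x.toKIdx G hG1 hU hη0.le a (β x.toKIdx.hN x.toKIdx.D x.toKIdx.hk y) hα₁.le hα₁4 ha z hs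
    have hwB : 0 < B9Thm311ReadingAtLetters.wB x.toKIdx (β x.toKIdx.hN x.toKIdx.D x.toKIdx.hk y) := B9Thm311ReadingAtLetters.wB_pos x.toKIdx _
    show ‖kFY x.toKIdx (parSymY x.toKIdx) U (mulY x.toKIdx (fluct (kGeo x.toKIdx).eta a) U) (β x.toKIdx.hN x.toKIdx.D x.toKIdx.hk y) z‖
      ≤ Cq * (Lr ^ 4 * α₁) * (B9Thm311ReadingAtLetters.wB x.toKIdx (β x.toKIdx.hN x.toKIdx.D x.toKIdx.hk y))⁻¹
    refine hk.trans ?_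
    have : Cq * α₁ * (B9Thm311ReadingAtLetters.wB x.toKIdx (β x.toKIdx.hN x.toKIdx.D x.toKIdx.hk y))⁻¹ ≤ Cq * (Lr ^ 4 * α₁) * (B9Thm311ReadingAtLetters.wB x.toKIdx (β x.toKIdx.hN x.toKIdx.D x.toKIdx.hk y))⁻¹ := by
      have h0 : 0 ≤ Cq * (B9Thm311ReadingAtLetters.wB x.toKIdx (β x.toKIdx.hN x.toKIdx.D x.toKIdx.hk y))⁻¹ * α₁ := by positivity
      nlinarith
    exact le_trans (le_of_eq (by rw [hCq])) this
  · -- (2) the starred variation letter `sF` ((3.59))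
    intro z
    have ha : ∀ (ν : Fin (d + 1)) (v : Site (PV d ℓ x.m x.K hd hL) 0), blkOf x.toKIdx.D.toDomains (toBox x.toKIdx.hN v) = blkOf x.toKIdx.D.toDomains z →
        η * ‖a ν v‖ ≤ α₁ * ((((ℓ + 1) ^ (blkOf x.toKIdx.D.toDomains z).1.1 : ℕ) : ℝ))⁻¹ := by
      intro ν v hv
      have hlev : levV1 x.toKIdx v = (blkOf x.toKIdx.D.toDomains z).1.1 := by
        show x.toKIdx.D.lev (toBox x.toKIdx.hN v).1 = _; rw [← hv]; rfl
      have hb := hA _ ν v (le_of_eq hlev.symm)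
      have e : scaleLen (kGeo x.toKIdx).L (kGeo x.toKIdx).eta (blkOf x.toKIdx.D.toDomains z).1.1 = (((ℓ + 1) ^ (blkOf x.toKIdx.D.toDomains z).1.1 : ℕ) : ℝ) * η := by
        rw [scaleLen, hLeq, ← hLn]; push_cast; ring
      rw [e, mul_inv] at hb
      calc η * ‖a ν v‖ ≤ η * (α₁ * (((((ℓ + 1) ^ (blkOf x.toKIdx.D.toDomains z).1.1 : ℕ) : ℝ))⁻¹ * η⁻¹)) := mul_le_mul_of_nonneg_left hb.le hη0.le
        _ = α₁ * ((((ℓ + 1) ^ (blkOf x.toKIdx.D.toDomains z).1.1 : ℕ) : ℝ))⁻¹ := by field_simp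
    have hs := norm_sFY_parSymY_le x.toKIdx G hG1 hU hη0.le a z hα₁.le hα₁4 ha
    show ‖sFY x.toKIdx (parSymY x.toKIdx) U (mulY x.toKIdx (fluct (kGeo x.toKIdx).eta a) U) z‖ ≤ Cq * (Lr ^ 4 * α₁)
    refine hs.trans ?_
    have : Cq * α₁ ≤ Cq * (Lr ^ 4 * α₁) := by nlinarith [mul_nonneg hCq0 hα₁.le]
    exact le_trans (le_of_eq (by rw [hCq])) this
  · -- (3)
    intro ν k z
    rw [hco, hexp]
    show ‖((η : ℂ)⁻¹) • covDstar (shiftY x.toKIdx) (UboxY x.toKIdx U) ν (chartA x.toKIdx a k) z‖ ≤ Lr ^ 4 * α₁ * ((geo9Y x).len (blkC x.toKIdx ιB z) ^ 2)⁻¹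
    refine (h3 ν k z).trans ?_
    have hw : 0 ≤ α₁ * ((geo9Y x).len (blkC x.toKIdx ιB z) ^ 2)⁻¹ := by positivity
    have hL2 : Lr ^ 2 ≤ Lr ^ 4 := pow_le_pow_right₀ hL1 (by norm_num)
    nlinarith
  · -- (4)
    intro μ ν z
    rw [hco, hexp]
    show ‖((η : ℂ)⁻¹) • covD (shiftY x.toKIdx) (UboxY x.toKIdx U) μ (chartA x.toKIdx a ν) z‖ ≤ Lr ^ 4 * α₁ * ((geo9Y x).len (blkC x.toKIdx ιB z) ^ 2)⁻¹
    have hd := hDA' μ ν z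
    rw [← covD_chart x.toKIdx U μ (a ν)] at hd
    refine hd.trans ?_
    have hw : 0 ≤ α₁ * ((geo9Y x).len (blkC x.toKIdx ιB z) ^ 2)⁻¹ := by positivity
    nlinarith
  · -- (5): `∇*_μ(τ*_μ a_μ)(z) = −R(…)⁻¹ ∇_μ(τ*_μ a_μ)(z − e_μ) = R(…)⁻¹ ∇*_μ a_μ (z − e_μ)`, then (3) at `z − e_μ` and one more neighbour step
    intro μ z
    rw [hco, hexp]
    show ‖((η : ℂ)⁻¹) • covDstar (shiftY x.toKIdx) (UboxY x.toKIdx U) μ (tauB (shiftY x.toKIdx) (UboxY x.toKIdx U) μ (chartA x.toKIdx a μ)) z‖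
      ≤ Lr ^ 4 * α₁ * ((geo9Y x).len (blkC x.toKIdx ιB z) ^ 2)⁻¹
    rw [covDstar_eq_neg_R_covD _ _ μ _ z, covD_tauB_eq_neg_covDstar, R_neg, neg_neg, ← R_smul]
    refine ((norm_R_le_of_unitaryLike (hUu μ _) _).2).trans ?_
    refine (h3 μ μ ((shiftY x.toKIdx μ).symm z)).trans ?_
    have := (hnb μ z).2
    calc Lr ^ 2 * α₁ * ((geo9Y x).len (blkC x.toKIdx ιB ((shiftY x.toKIdx μ).symm z)) ^ 2)⁻¹
        ≤ Lr ^ 2 * α₁ * (Lr ^ 2 * ((geo9Y x).len (blkC x.toKIdx ιB z) ^ 2)⁻¹) := mul_le_mul_of_nonneg_left this (by positivity)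
      _ = Lr ^ 4 * α₁ * ((geo9Y x).len (blkC x.toKIdx ιB z) ^ 2)⁻¹ := by ring
  · -- (6)
    intro k z
    rw [hexp]
    show ‖a k ((boxEquiv x.toKIdx.hN).symm z)‖ ≤ Lr ^ 4 * α₁ * ((geo9Y x).len (blkC x.toKIdx ιB z))⁻¹
    refine (hA' k z).trans ?_
    have hw : 0 ≤ α₁ * ((geo9Y x).len (blkC x.toKIdx ιB z))⁻¹ := mul_nonneg hα₁.le (inv_nonneg.2 (hlen0 z).le)
    nlinarith
  · -- (7)
    intro ν k z
    rw [hco, hexp]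
    show ‖tauB (shiftY x.toKIdx) (UboxY x.toKIdx U) ν (chartA x.toKIdx a k) z‖ ≤ Lr ^ 4 * α₁ * ((geo9Y x).len (blkC x.toKIdx ιB z))⁻¹
    have ht : tauB (shiftY x.toKIdx) (UboxY x.toKIdx U) ν (chartA x.toKIdx a k) z = R (UboxY x.toKIdx U ν ((shiftY x.toKIdx ν).symm z))⁻¹ (chartA x.toKIdx a k ((shiftY x.toKIdx ν).symm z)) := rfl
    rw [ht]
    refine ((norm_R_le_of_unitaryLike (hUu ν _) _).2).trans ?_
    refine (hA' k ((shiftY x.toKIdx ν).symm z)).trans ?_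
    have := (hnb ν z).1
    have hw : 0 ≤ α₁ * ((geo9Y x).len (blkC x.toKIdx ιB z))⁻¹ := mul_nonneg hα₁.le (inv_nonneg.2 (hlen0 z).le)
    have hL3 : Lr ≤ Lr ^ 4 := by
      calc Lr = Lr ^ 1 := (pow_one _).symm
        _ ≤ Lr ^ 4 := pow_le_pow_right₀ hL1 (by norm_num)
    calc α₁ * ((geo9Y x).len (blkC x.toKIdx ιB ((shiftY x.toKIdx ν).symm z)))⁻¹
        ≤ α₁ * (Lr * ((geo9Y x).len (blkC x.toKIdx ιB z))⁻¹) := mul_le_mul_of_nonneg_left this hα₁.le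
      _ = Lr * (α₁ * ((geo9Y x).len (blkC x.toKIdx ιB z))⁻¹) := by ring
      _ ≤ Lr ^ 4 * (α₁ * ((geo9Y x).len (blkC x.toKIdx ιB z))⁻¹) := mul_le_mul_of_nonneg_right hL3 hw
      _ = _ := by ring

end Letters

/-! ## §3 The coded class `C37` and the dictionary `hC37` -/

section Class

variable [NormOneClass 𝔸] {Mstar : ℕ} (G : Subgroup 𝔸ˣ) (x : MemberY d ℓ hd hL b₀ b₁ Mstar) (ιB : BlkY x.toKIdx → IBondY x.toKIdx)

/-- **THE CODED CLASS (3.37) OF THE SECT.-B CHAIN AT NODE 00**: a pair (base `U`, field `a`) is in the class at exponent `β` iff `U` is `G`-valued and the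
seven letter bounds `CplxLettersY` (transporter `parSymY`, constant `Cq`) hold at `β`. [cite: Balaban1985BackgroundPropagators, (3.37) p.396, (3.58)–(3.59) p.402] -/
def C37Y (Cq : ℝ) : ℝ → CfgY 𝔸 x.toKIdx → AfldY 𝔸 x.toKIdx → Prop :=
  fun β U a => GVal G x.toKIdx U ∧ CplxLettersY G x (parSymY x.toKIdx) ιB Cq β U a

omit [NormOneClass 𝔸] in
/-- the class implies «`U` is `G`-valued». [cite: Balaban1985BackgroundPropagators, (3.35) p.396, bookkeeping] -/
theorem gVal_of_C37Y {Cq β : ℝ} {U : CfgY 𝔸 x.toKIdx} {a : AfldY 𝔸 x.toKIdx} (h : C37Y G x ιB Cq β U a) : GVal G x.toKIdx U := h.1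

omit [NormOneClass 𝔸] in
/-- ★ **THE DICTIONARY `hC37` OF `gpFrame₂Coded` HOLDS BY DEFINITION** for `C37 := C37Y`. [cite: Balaban1985BackgroundPropagators, (3.37) p.396, bookkeeping] -/
theorem cplxLettersY_of_C37Y (Cq : ℝ) :
    ∀ β (U : CfgY 𝔸 x.toKIdx) (a : AfldY 𝔸 x.toKIdx), C37Y G x ιB Cq β U a → GVal G x.toKIdx U ∧ CplxLettersY G x (parSymY x.toKIdx) ιB Cq β U a :=
  fun _ _ _ h => h

/-! ## §4 ★★ The class hypothesis `hclass` of `sectBStepPrinted_of_coded` -/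

/-- ★★ **`hclass` AT ONE MEMBER**: above `2(d+1) < M`, every `U′` of the record's class (3.37) at a (3.35)-regular `U` and exponent `0 < α₁ ≤ 1∕4` has the
code `a := A′` (`U′ = e^{iηA′}`) in the coded class `C37Y` at exponent `L⁴α₁` — the section `ιB` of this member given (`hι`).
[cite: Balaban1985BackgroundPropagators, (3.37) p.396, (3.35) p.396, Thm 3.4 p.400] -/
theorem hclass_C37Y_at (hι : ∀ s : BlkY x.toKIdx, β x.toKIdx.hN x.toKIdx.D x.toKIdx.hk (ιB s) = s)
    (hG1 : ∀ u : 𝔸ˣ, u ∈ G → ‖(u : 𝔸)‖ ≤ 1) (hdM : 2 * ((d : ℝ) + 1) < (geo9Y x).M) {c35 α₀ α₁ : ℝ} {U U' : (bg9Y 𝔸 G x).Cfg}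
    (hreg : (bg9Y 𝔸 G x).Reg335 c35 α₀ U) (hα₁ : 0 < α₁) (hα₁4 : α₁ ≤ 1 / 4) (h37 : (bg9Y 𝔸 G x).Cplx337 α₁ U U') :
    ∃ a : AfldY 𝔸 x.toKIdx, fluct (kGeo x.toKIdx).eta a = U' ∧
      C37Y G x ιB (4 * ((d : ℝ) + 1) * Real.exp (3 * (((d : ℝ) + 1) / 2))) ((((ℓ : ℝ) + 1) ^ 4) * α₁) U a := by
  obtain ⟨A', hU', hcl⟩ := h37
  exact ⟨A', hU'.symm, hreg.1.1, cplxLettersY_of_cplx337 G x ιB hι hG1 hdM hreg.1.1 hα₁ hα₁4 hcl⟩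

/-- ★★ **THE CLASS HYPOTHESIS `hclass` OF `B9SectBCodedCarrier.sectBStepPrinted_of_coded`, LITERALLY**, for the codings `codingYx G x (C37Y …) (C38 x)` of the
member family: `r := L⁴`, `αcap := 1∕4`, `Mc := 2(d+1)+1`, any `ac`.  (Family-level: carries the ∀x-section binder `hι`, see HONEST SCOPE.)
[cite: Balaban1985BackgroundPropagators, (3.37) p.396, Thm 3.4 p.400] -/
theorem hclass_C37Y [∀ x : MemberY d ℓ hd hL b₀ b₁ Mstar, Fintype (geo9Y x).Site]
    (ιBf : ∀ x : MemberY d ℓ hd hL b₀ b₁ Mstar, BlkY x.toKIdx → IBondY x.toKIdx)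
    (hι : ∀ (x : MemberY d ℓ hd hL b₀ b₁ Mstar) (s : BlkY x.toKIdx), β x.toKIdx.hN x.toKIdx.D x.toKIdx.hk (ιBf x s) = s)
    (hG1 : ∀ u : 𝔸ˣ, u ∈ G → ‖(u : 𝔸)‖ ≤ 1) (C38 : ∀ x : MemberY d ℓ hd hL b₀ b₁ Mstar, ℝ → CfgY 𝔸 x.toKIdx → AfldY 𝔸 x.toKIdx → Prop)
    (c35 ac : ℝ) :
    ∀ (x : MemberY d ℓ hd hL b₀ b₁ Mstar) (α₀ α₁ : ℝ) (U U' : (bg9Y 𝔸 G x).Cfg), 2 * ((d : ℝ) + 1) + 1 ≤ (geo9Y x).M → 0 < α₀ → (geo9Y x).M * α₀ ≤ ac →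
      (bg9Y 𝔸 G x).Reg335 c35 α₀ U → 0 < α₁ → α₁ ≤ 1 / 4 → (bg9Y 𝔸 G x).Cplx337 α₁ U U' →
      ∃ a : (codingYx G x (C37Y G x (ιBf x) (4 * ((d : ℝ) + 1) * Real.exp (3 * (((d : ℝ) + 1) / 2)))) (C38 x)).A,
        (codingYx G x (C37Y G x (ιBf x) (4 * ((d : ℝ) + 1) * Real.exp (3 * (((d : ℝ) + 1) / 2)))) (C38 x)).decA a = U' ∧
        (codingYx G x (C37Y G x (ιBf x) (4 * ((d : ℝ) + 1) * Real.exp (3 * (((d : ℝ) + 1) / 2)))) (C38 x)).C37 ((((ℓ : ℝ) + 1) ^ 4) * α₁) U a := by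
  intro x α₀ α₁ U U' hM _ _ hreg hα₁ hα₁4 h37
  exact hclass_C37Y_at G x (ιBf x) (hι x) hG1 (by linarith) hreg hα₁ hα₁4 h37

end Class

/-! ## §5 The per-member section hypothesis `hι` is satisfiable: corner-free members exist -/

section CornerFree

variable {Mstar : ℕ}

/-- ★ **CORNER-FREE MEMBERS EXIST** (so the per-member statements carrying `hι` — this file's §2–§4, `B9SectBGpTransferConvY.hconv_at`, `hclass_C37Y_at`, the
per-member theorems of FILES 3∕4∕5∕7 — are NON-VACUOUS at served members): at `L = 5` (`ℓ = 4`, the one size at which the tree places top-level cubes,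
`B9PinMembersKLevelV1.kIdx_topConst_L5`), for every `k ≥ 2`, band `0 < b₀ ≤ b₁` and real `M₂` there is a member with `x.k = k`, `M₂ ≤ M` and `β` ONTO `𝔅`
(`Ω_k = T_η`: every block is a top-level block, nothing is deep, `B9BetaRangeKLevelV1.surjective_beta_iff`), hence with a section `ιB := Function.surjInv`.
(The refutation of the FAMILY-LEVEL `∀ x, hι x` — def-Y `not_forall_memberY_beta_section` — and this existence are consistent: the member type has both kinds.)
[cite: Balaban1984PropagatorsII, (2.1)–(2.4) p.224 («We admit the case when some domains Ω_j are equal to T_η»), (2.45) p.231; Balaban1985BackgroundPropagators, p.399 (the family)] -/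
theorem exists_memberY_surjective_beta (hℓ : 4 ≤ ℓ) (hℓ4 : ℓ ≤ 4) {k : ℕ} (hk : 2 ≤ k) (hb₀ : 0 < b₀) (hb₁ : b₀ ≤ b₁) (M₂ : ℝ) :
    ∃ x : MemberY d ℓ hd hL b₀ b₁ Mstar, x.k = k ∧ M₂ ≤ (geo9Y x).M ∧ Function.Surjective (β x.toKIdx.hN x.toKIdx.D x.toKIdx.hk) := by
  obtain ⟨i, hik, hcf, hM, hlev⟩ := B9PinMembersKLevelV1.kIdx_topConst_L5 (d := d) (hd := hd) (hL := hL) hℓ hℓ4 hk hb₀ hb₁ (max M₂ (Mstar : ℝ))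
  have hMstar : Mstar ≤ (ℓ + 1) * i.Mh := by
    have h : (Mstar : ℝ) ≤ ((ℓ + 1 : ℕ) : ℝ) * (i.Mh : ℝ) := (le_max_right _ _).trans hM
    exact_mod_cast h
  refine ⟨MemberY.diag i hcf hMstar, hik, (le_max_left _ _).trans hM, ?_⟩
  show Function.Surjective (β i.hN i.D i.hk)
  have hk1 : 1 ≤ i.k := le_trans one_le_two i.hk2
  refine (B9BetaRangeKLevelV1.surjective_beta_iff i.hN i.D i.hk hk1).2 fun x0 => Or.inl ⟨0, ?_⟩
  have hkle : (B6GlobalChartV1.domT i.hN i.D i.hk).k ≤ i.D.lev (toBox i.hN x0 : Fin (d + 1) → ℤ) := by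
    show i.k ≤ _
    have h1 : i.D.lev (toBox i.hN x0 : Fin (d + 1) → ℤ) = k := hlev _
    omega
  exact B6SectADomainsV1.Domains.not_deep_of_le _ hkle _

/-- … hence a member and a section `ιB` of its `β` (`hι`) exist together. [cite: Balaban1984PropagatorsII, (2.45) p.231, bookkeeping] -/
theorem exists_memberY_section (hℓ : 4 ≤ ℓ) (hℓ4 : ℓ ≤ 4) {k : ℕ} (hk : 2 ≤ k) (hb₀ : 0 < b₀) (hb₁ : b₀ ≤ b₁) (M₂ : ℝ) :
    ∃ (x : MemberY d ℓ hd hL b₀ b₁ Mstar) (ιB : BlkY x.toKIdx → IBondY x.toKIdx),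
      x.k = k ∧ M₂ ≤ (geo9Y x).M ∧ ∀ s : BlkY x.toKIdx, β x.toKIdx.hN x.toKIdx.D x.toKIdx.hk (ιB s) = s := by
  obtain ⟨x, hk', hM, hs⟩ := exists_memberY_surjective_beta (d := d) (hd := hd) (hL := hL) (Mstar := Mstar) hℓ hℓ4 hk hb₀ hb₁ M₂
  exact ⟨x, Function.surjInv hs, hk', hM, Function.surjInv_eq hs⟩

end CornerFree

end Literature.MathematicalPhysics.QuantumFieldTheory.Balaban1983to89.B9SectBCodedClassY
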